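import Summits.BirchSwinnertonDyer.Rank1Residual.Additive.SignedTwistLocalDictionary
import Summits.BirchSwinnertonDyer.Rank1Residual.Additive.SignedTwistKummerInvisibility
import HarnessLib

/-!
# (P5-3b) The KUMMER DICTIONARY at `p` of the signed-`η` twist: `x ∈ Kummer_W(E^{−,str}(ℚ_n·E))`
# `↔ Θ_n x ∈ Kummer_V(E⁻(K_{n,v}))` (`cells/n1011/skel/T-O7ss-P5.md` §2 (D4c))
(cell `b2b-bsdres`, team n1011, seat n1011-p17 GEN 7; row T-O7ss-P13 follow-up (P5), file P5-3b;
designs (A)(B) APPROVED by referee-1 GEN 22)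

HONEST FRAMING (cell `b2b-bsdres`, run/shared/lean/b2b/bsd-rank1-residual/, verbatim in every
file): the goal of the cell is to DELETE the COMBINATION-SHAPED residual classes of the
Birch–Swinnerton-Dyer formula for ALL analytic-rank `≤ 1` elliptic curves over `ℚ` — "full BSD
formula for every rank `≤ 1` curve in class `C`" assembled STRICTLY from published theorems — so
that the rank-`≤ 1` remainder becomes exactly the CONSTRUCTION-SHAPED classes, which are TYPED
(missing-input `Prop`s), NOT attempted. This is not "finishing BSD". Research route on
O7-ss ∩ (G)∧ss ∩ e = 2 (OPEN) / X4 CONSTRUCTION-SHAPED; nothing here is booked; no label moves.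
TOOL THEOREMS ONLY: no definition, no named Literature fact, no `sorry`; axioms standard.


(`h1TransportLayer` is a transparent composite `Θ_* ∘ res`.) Binders: `hD` = (D0) unfolded at
`closureEmb E`; `hκ₀` = `κ(Gal(ℚ̄/K₀)) = ℤ_p` (RESHAPE, see P5-2a); `hη` pins `η`; for (←) also
`hcop : p ∤ [Γ_ℚ : Gal(ℚ̄/K₀)]` (the skeleton's) and the frame instance `[(galRange K₀).Normal]`.
The statements are at the CHOSEN embedding `closureEmb E`, as in both Selmer definitions (F2a's
`strictSignedSelmerLayer`, cc-typer-6's `towerSignedSelmerLayer`); conjugate places are handled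
there by `conj_σ`, not by other embeddings. No `p ≠ 2`.

## What is proved
* `towerSubgroup_le_layerSubgroup`, `h1TransportLayer` (`Θ_n = Θ_* ∘ res_{K₀ℚ_n/ℚ_n}`),
  `resOfLe_oneCocycleClass`;
* **`h1TransportLayer_mem_localKummer_towerSigned`** (D4c →): witness `(Θ∘φ∘incl, ΨQ, k)` from a
  zero-clause witness (invisibility + (D4b1) + the local square `pointsMap_geomTransport`);
* `mem_of_coprime_nsmul_mem`, `card_layerQuotient_dvd_index_galRange`
  (`[K_{n,v} : ℚ_{n,p}] ∣ [Γ_ℚ : Gal(ℚ̄/K₀)]`);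
* **`mem_localKummer_strictSigned_of_h1TransportLayer_mem`** (D4c ←): coboundary absorption, the
  cochain lemma (G1) with `Q₂ = Tr_{K_{n,v}/ℚ_{n,p}}(Ψ⁻¹R') − m₀`, whose `p`-power multiple is the
  η-average of (D4b3), and prime-to-`p` division;
* **`mem_localKummerOverOfEmb_strictSigned_iff`** (D4c).

References: S. Kobayashi, Invent. Math. 152 (2003) §2 p. 4, Def. 1.1, Def. 2.1 [Kobayashi2003];
J.-P. Serre, *Galois Cohomology* I.§2.4 [SerreGaloisCohomology1997].
-/

noncomputable section

open scoped Classical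

open WeierstrassCurve Field

namespace Summit.BirchSwinnertonDyer.Rank1Residual.Additive.SignedTwist

open Literature.NumberTheory.EllipticCurves Literature.NumberTheory.GaloisRepresentations
  Literature.NumberTheory.EllipticCurves.Kobayashi2003
  Summit.BirchSwinnertonDyer.Rank1Residual.AdditivePotMult

section KummerForward

open ZpExtension

variable (W : WeierstrassCurve ℚ) (K₀ : Type) [Field K₀] [NumberField K₀] {θ : K₀} {c : ℚ}
  (hθ : θ ∉ Set.range (algebraMap ℚ K₀)) (hc : θ ^ 2 = algebraMap ℚ K₀ c)
  (p : ℕ) [Fact p.Prime] (κ : ZpExtension ℚ p)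
  {V : WeierstrassCurve ℚ} {C : VariableChange ℚ} (hCV : C • W.quadraticTwist c = V)
  (E : Type) [Field E] [Algebra ℚ E]
  (η : absoluteGaloisGroup ℚ →* ℤˣ)
  (hη : ∀ σ : absoluteGaloisGroup ℚ, η σ = 1 ↔ σ • rootInClosure K₀ θ = rootInClosure K₀ θ)

/-- `Gal(ℚ̄/K₀ℚ_n) ≤ Gal(ℚ̄/ℚ_n)`. [folklore] -/
theorem towerSubgroup_le_layerSubgroup (n : ℕ) : towerSubgroup κ K₀ n ≤ κ.layerSubgroup n :=
  fun σ hσ ↦ ((mem_towerSubgroup_iff κ K₀ n σ).mp hσ).1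

/-- **`Θ_n : H¹(ℚ_n, W[p^∞]) → H¹(K₀ℚ_n, V[p^∞])`** = restriction to `Gal(ℚ̄/K₀ℚ_n)` followed by the
transport `Θ_*` (P5-1b `h1Transport`). [cite: Kobayashi2003, §2 p. 4] -/
abbrev h1TransportLayer (n : ℕ) :
    W.subgroupH1 p (κ.layerSubgroup n) →+ V.subgroupH1 p (towerSubgroup κ K₀ n) :=
  (h1Transport W K₀ hθ hc p hCV (towerSubgroup κ K₀ n) (towerSubgroup_le_galRange κ K₀ n) :
      W.subgroupH1 p (towerSubgroup κ K₀ n) →+ V.subgroupH1 p (towerSubgroup κ K₀ n)).comp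
    (W.resOfLe p (towerSubgroup_le_layerSubgroup K₀ p κ n))

omit [Fact p.Prime] in
/-- `res_{H ≤ H'} [f] = [f ∘ incl]` on explicit cocycles (`map_oneCocycleClass`). [folklore] -/
theorem resOfLe_oneCocycleClass {H H' : Subgroup (absoluteGaloisGroup ℚ)} (h : H ≤ H')
    (f : contOneCocycles (discreteTopRep H' (W.geomPrimaryTorsion p))) :
    W.resOfLe p h (oneCocycleClass _ f) =
      oneCocycleClass (discreteTopRep H (W.geomPrimaryTorsion p))
        (contOneCocycles.pullback (subgroupInclusion h)
          (resHomOfEquivariant (subgroupInclusion h) (AddMonoidHom.id (W.geomPrimaryTorsion p))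
            fun _ _ ↦ rfl) f) :=
  map_oneCocycleClass _ _ _ f

/-- **(D4c →)**: a class of `H¹(ℚ_n·(−), W[p^∞])` over `Gal(ℚ̄/ℚ_n)` satisfying p17's STRICT signed
Kummer condition at the chosen embedding goes, under `Θ_n`, to a class satisfying cc-typer-6's
VERBATIM minus Kummer condition (`E⁻_V(K_{n,v})` with the `m = −1` clause): witness
`(Θ ∘ φ ∘ incl, Ψ Q, k)` from a zero-clause witness `(φ, Q, k)` (invisibility + (D4b1) + the local
square). [cite: Kobayashi2003, §2 p. 4, Def. 1.1, Def. 2.1] -/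
theorem h1TransportLayer_mem_localKummer_towerSigned
    (hD : ∀ g : absoluteGaloisGroup ℚ, ∃ τ : absoluteGaloisGroup E,
      (resGalOfEmb (closureEmb (K := ℚ) E) τ)⁻¹ * g ∈ towerTopSubgroup κ K₀)
    (hκ₀ : ∀ x, ∃ g ∈ galRange (K := ℚ) K₀, κ g = x) (n : ℕ)
    {x : W.subgroupH1 p (κ.layerSubgroup n)}
    (hx : x ∈ localKummerOverOfEmb W p (κ.layerSubgroup n) (closureEmb (K := ℚ) E)
      (strictSignedLocalPointsOfEmb κ (closureEmb (K := ℚ) E) W (-1) n)) :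
    h1TransportLayer W K₀ hθ hc p κ hCV n x ∈
      localKummerOverOfEmb V p (towerSubgroup κ K₀ n) (closureEmb (K := ℚ) E)
        (towerSignedLocalPointsOfEmb (towerSubgroup κ K₀) (closureEmb (K := ℚ) E) V (-1) n) := by
  have hclosed : IsClosed ((κ.layerSubgroup n : Subgroup (absoluteGaloisGroup ℚ)) :
      Set (absoluteGaloisGroup ℚ)) :=
    Subgroup.isClosed_of_isOpen _ (κ.isOpen_layerSubgroup n)
  rw [localKummerOverOfEmb_strictSigned_eq_zeroClause W p κ (closureEmb (K := ℚ) E) _ hclosed n]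
    at hx
  obtain ⟨φ, Q, k, hxφ, hA, hφ⟩ := hx
  obtain ⟨hP, hT⟩ := AddSubgroup.mem_inf.mp hA
  have h1 := towerSubgroup_le_layerSubgroup K₀ p κ n
  -- the transported cocycle `Θ ∘ φ ∘ incl` on `Gal(ℚ̄/K₀ℚ_n)`
  let φU := contOneCocycles.pullback (subgroupInclusion h1)
    (resHomOfEquivariant (subgroupInclusion h1) (AddMonoidHom.id (W.geomPrimaryTorsion p))
      fun _ _ ↦ rfl) φ
  refine ⟨contOneCocycles.push
      (geomTransport W K₀ hθ hc p hCV : W.geomPrimaryTorsion p →+ V.geomPrimaryTorsion p)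
      (geomTransport_smul_of_le W K₀ hθ hc p hCV (towerSubgroup_le_galRange κ K₀ n)) φU,
    localTransport W K₀ hθ hc hCV E (closureEmb (K := ℚ) E) Q, k, ?_, ?_, fun τ ↦ ?_⟩
  · -- the class: `Θ_n [φ] = [Θ ∘ φ ∘ incl]`
    rw [← hxφ, AddMonoidHom.comp_apply, resOfLe_oneCocycleClass, AddMonoidHom.coe_coe, h1Equiv_apply,
      Literature.NumberTheory.EllipticCurves.resH1Hom_id_oneCocycleClass]
  · -- `p^k • Ψ Q = Ψ (p^k • Q) ∈ E⁻_V(K_n)` by (D4b1)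
    rw [← map_nsmul]
    exact localTransport_mem_towerSigned W K₀ hθ hc κ hCV (closureEmb (K := ℚ) E) hD hκ₀ hP
      ((AddMonoidHom.mem_ker).mp hT)
  · -- the local shape, through the local square and the `Gal(ℚ̄/K₀)`-equivariance of `Ψ`
    have hw := hφ (Subgroup.inclusion (localSubgroupOfEmb_tower_le_layer K₀ κ (closureEmb (K := ℚ) E) n) τ)
    rw [show resGalSubgroupOfEmb (κ.layerSubgroup n) (closureEmb (K := ℚ) E)
        (Subgroup.inclusion (localSubgroupOfEmb_tower_le_layer K₀ κ (closureEmb (K := ℚ) E) n) τ) =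
        subgroupInclusion h1 (resGalSubgroupOfEmb (towerSubgroup κ K₀ n) (closureEmb (K := ℚ) E) τ)
        from Subtype.ext rfl, Subgroup.coe_inclusion] at hw
    rw [contOneCocycles.push_apply, contOneCocycles.pullback_apply]
    change pointsMap V E ((geomTransport W K₀ hθ hc p hCV
      (φ.1 (subgroupInclusion h1 (resGalSubgroupOfEmb (towerSubgroup κ K₀ n) (closureEmb (K := ℚ) E) τ))) :
        V.geomPrimaryTorsion p) : V.geomPoints) = _
    rw [pointsMap_geomTransport]
    change localTransport W K₀ hθ hc hCV E (closureEmb (K := ℚ) E)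
      (pointsMapOfEmb W (closureEmb (K := ℚ) E) _) = _
    rw [hw, map_sub, localTransport_smul_of_smul_root_eq W K₀ hθ hc hCV E (closureEmb (K := ℚ) E)
      (apply_rootInClosure_of_mem K₀ (towerSubgroup_le_galRange κ K₀ n τ.2))]

end KummerForward

section KummerBackward

open ZpExtension

variable (W : WeierstrassCurve ℚ) (K₀ : Type) [Field K₀] [NumberField K₀] {θ : K₀} {c : ℚ}
  (hθ : θ ∉ Set.range (algebraMap ℚ K₀)) (hc : θ ^ 2 = algebraMap ℚ K₀ c)
  (p : ℕ) [Fact p.Prime] (κ : ZpExtension ℚ p)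
  {V : WeierstrassCurve ℚ} {C : VariableChange ℚ} (hCV : C • W.quadraticTwist c = V)
  (E : Type) [Field E] [Algebra ℚ E]
  (η : absoluteGaloisGroup ℚ →* ℤˣ)
  (hη : ∀ σ : absoluteGaloisGroup ℚ, η σ = 1 ↔ σ • rootInClosure K₀ θ = rootInClosure K₀ θ)

/-- If `pʲ x = 0`, `d` is prime to `p` and `d • x ∈ S` then `x ∈ S`. [folklore] -/
theorem mem_of_coprime_nsmul_mem {A : Type*} [AddCommGroup A] (S : AddSubgroup A) {x : A} {j d : ℕ}
    (hx : p ^ j • x = 0) (hd : d.Coprime p) (hdx : d • x ∈ S) : x ∈ S := by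
  have hp : p.Prime := Fact.out
  obtain ⟨u, -, hu⟩ := Nat.exists_mul_mod_eq_one_of_coprime (hd.pow_right (j + 1))
    (Nat.one_lt_pow (Nat.succ_ne_zero j) hp.one_lt)
  have hj1 : p ^ (j + 1) • x = 0 := by rw [pow_succ', mul_nsmul', hx, nsmul_zero]
  have h := Nat.div_add_mod (d * u) (p ^ (j + 1))
  rw [hu] at h
  have hx' : (d * u) • x = x := by
    calc (d * u) • x = (p ^ (j + 1) * (d * u / p ^ (j + 1)) + 1) • x := by rw [h]
      _ = x := by rw [add_nsmul, one_nsmul, mul_nsmul, hj1, nsmul_zero, zero_add]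
  rw [← hx', mul_nsmul]
  exact AddSubgroup.nsmul_mem _ hdx _

/-- `[Gal(ℚ̄_E/ℚ_n·E) : Gal(ℚ̄_E/K₀ℚ_n·E)]` divides `[Γ_ℚ : Gal(ℚ̄/K₀)]` (`Gal(ℚ̄/K₀)` normal).
[folklore] -/
theorem card_layerQuotient_dvd_index_galRange [(galRange (K := ℚ) K₀).Normal]
    (ι : AlgebraicClosure ℚ →ₐ[ℚ] AlgebraicClosure E) (n : ℕ)
    [Fintype (localLayerSubgroupOfEmb κ ι n ⧸
      (localSubgroupOfEmb (towerSubgroup κ K₀ n) ι).subgroupOf (localLayerSubgroupOfEmb κ ι n))] :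
    Fintype.card (localLayerSubgroupOfEmb κ ι n ⧸
      (localSubgroupOfEmb (towerSubgroup κ K₀ n) ι).subgroupOf (localLayerSubgroupOfEmb κ ι n)) ∣
      (galRange (K := ℚ) K₀).index := by
  rw [← Nat.card_eq_fintype_card]
  change ((towerSubgroup κ K₀ n).comap (resGalOfEmb ι).toMonoidHom).relIndex
    ((κ.layerSubgroup n).comap (resGalOfEmb ι).toMonoidHom) ∣ _
  rw [Subgroup.relIndex_comap,
    show towerSubgroup κ K₀ n = galRange (K := ℚ) K₀ ⊓ κ.layerSubgroup n from inf_comm _ _,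
    ← Subgroup.relIndex_inf_mul_relIndex,
    Subgroup.relIndex_eq_one.mpr (Subgroup.map_comap_le _ _), mul_one]
  exact Subgroup.relIndex_dvd_index_of_normal _ _

include hθ hη in
/-- **(D4c ←)**: conversely, if `Θ_n x` satisfies cc-typer-6's verbatim minus Kummer condition then
`x` satisfies p17's strict signed Kummer condition. From a `V`-witness `(φ_V, R, k)`: absorb the
coboundary `φ_V − Θ∘φ∘incl = ∂m` into `R`, pull back `Q := Ψ⁻¹ R'`, so that `ψ := ι_* ∘ φ ∘ res` is
principal (`= ∂Q`) on `Gal(ℚ̄_E/K₀ℚ_n·E)`; the COCHAIN LEMMA (G1) makes `d • ψ` principal on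
`Gal(ℚ̄_E/ℚ_n·E)` with point `Q₂ = Tr(Q) − m₀`, whose `p`-power multiple is the η-average trace of
(D4b3), hence in the zero-clause group; finally `d = [K_{n,v} : ℚ_{n,p}] ∣ [K₀ : ℚ]` is prime to `p`
(`hcop`) and `x` is `p`-primary. [cite: Kobayashi2003, §2 p. 4, Def. 1.1, Def. 2.1] -/
theorem mem_localKummer_strictSigned_of_h1TransportLayer_mem [(galRange (K := ℚ) K₀).Normal]
    (hD : ∀ g : absoluteGaloisGroup ℚ, ∃ τ : absoluteGaloisGroup E,
      (resGalOfEmb (closureEmb (K := ℚ) E) τ)⁻¹ * g ∈ towerTopSubgroup κ K₀)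
    (hκ₀ : ∀ x, ∃ g ∈ galRange (K := ℚ) K₀, κ g = x)
    (hcop : (galRange (K := ℚ) K₀).index.Coprime p) (n : ℕ)
    {x : W.subgroupH1 p (κ.layerSubgroup n)}
    (hx : h1TransportLayer W K₀ hθ hc p κ hCV n x ∈
      localKummerOverOfEmb V p (towerSubgroup κ K₀ n) (closureEmb (K := ℚ) E)
        (towerSignedLocalPointsOfEmb (towerSubgroup κ K₀) (closureEmb (K := ℚ) E) V (-1) n)) :
    x ∈ localKummerOverOfEmb W p (κ.layerSubgroup n) (closureEmb (K := ℚ) E)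
      (strictSignedLocalPointsOfEmb κ (closureEmb (K := ℚ) E) W (-1) n) := by
  classical
  have hp : p.Prime := Fact.out
  have h1 := towerSubgroup_le_layerSubgroup K₀ p κ n
  -- notation
  let ι : AlgebraicClosure ℚ →ₐ[ℚ] AlgebraicClosure E := closureEmb (K := ℚ) E
  let Θ := geomTransport W K₀ hθ hc p hCV
  let Ψ := localTransport W K₀ hθ hc hCV E ι
  let B := localLayerSubgroupOfEmb κ ι n
  haveI hUnN : (localSubgroupOfEmb (towerSubgroup κ K₀ n) ι).Normal := Subgroup.normal_comap _
  let N : Subgroup B := (localSubgroupOfEmb (towerSubgroup κ K₀ n) ι).subgroupOf B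
  haveI : N.Normal := inferInstance
  haveI : Fintype (B ⧸ N) := Fintype.ofFinite _
  -- a representative of `x` and the `V`-witness
  obtain ⟨φ, rfl⟩ := oneCocycleClass_surjective _ x
  obtain ⟨φV, R, k, hclass, hR, hφV⟩ := hx
  -- `Θ ∘ φ ∘ incl` also represents `Θ_n x`
  let φU := contOneCocycles.pullback (subgroupInclusion h1)
    (resHomOfEquivariant (subgroupInclusion h1) (AddMonoidHom.id (W.geomPrimaryTorsion p))
      fun _ _ ↦ rfl) φ
  let φV' := contOneCocycles.push (Θ : W.geomPrimaryTorsion p →+ V.geomPrimaryTorsion p)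
      (geomTransport_smul_of_le W K₀ hθ hc p hCV (towerSubgroup_le_galRange κ K₀ n)) φU
  have hclass' : oneCocycleClass _ φV' =
      h1TransportLayer W K₀ hθ hc p κ hCV n (oneCocycleClass _ φ) := by
    rw [AddMonoidHom.comp_apply, resOfLe_oneCocycleClass, AddMonoidHom.coe_coe, h1Equiv_apply,
      Literature.NumberTheory.EllipticCurves.resH1Hom_id_oneCocycleClass]
  -- the coboundary `φV − φV' = ∂m`, `m ∈ V[p^∞]` of order `p^{k₁}`
  have hdiff : oneCocycleClass _ (φV - φV') = 0 := by
    rw [← oneCocycleClassₗ_apply, map_sub, oneCocycleClassₗ_apply, oneCocycleClassₗ_apply, hclass,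
      hclass', sub_self]
  obtain ⟨m, hm⟩ := (oneCocycleClass_eq_zero_iff _ _).mp hdiff
  obtain ⟨k₁, hk₁⟩ := AddCommGroup.mem_primaryComponent.mp m.2
  have hval : ∀ σ : towerSubgroup κ K₀ n,
      φV.1 σ = Θ (φ.1 (subgroupInclusion h1 σ)) + (σ • m - m) := by
    intro σ
    have h := hm σ
    rw [Submodule.coe_sub, ContinuousMap.sub_apply, sub_eq_iff_eq_add'] at h
    rw [h]
    rfl
  -- the corrected point `R' = R − ι_* m`
  let mE : localPoints V E := pointsMapOfEmb V ι ((m : V.geomPrimaryTorsion p) : V.geomPoints)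
  let R' : localPoints V E := R - mE
  have hmE : p ^ k₁ • mE = 0 := by
    change p ^ k₁ • pointsMapOfEmb V ι _ = 0
    rw [← map_nsmul, hk₁, map_zero]
  have hR' : p ^ (k + k₁) • R' =
      p ^ k₁ • (p ^ k • R) := by
    change p ^ (k + k₁) • (R - mE) = _
    rw [smul_sub, pow_add, mul_nsmul, mul_nsmul', hmE, smul_zero, sub_zero]
  have hR'mem : p ^ (k + k₁) • R' ∈
      towerSignedLocalPointsOfEmb (towerSubgroup κ K₀) ι V (-1) n := by
    rw [hR']; exact AddSubgroup.nsmul_mem _ hR _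
  have hΘφ : ∀ τ : localSubgroupOfEmb (towerSubgroup κ K₀ n) ι,
      pointsMapOfEmb V ι ((Θ (φ.1 (subgroupInclusion h1
        (resGalSubgroupOfEmb (towerSubgroup κ K₀ n) ι τ))) : V.geomPrimaryTorsion p) : V.geomPoints) =
          (τ : absoluteGaloisGroup E) • R' - R' := by
    intro τ
    have h := hφV τ
    rw [hval, AddMemClass.coe_add, AddSubgroupClass.coe_sub, Subgroup.smul_def, primaryComponent.coe_smul,
      resGalSubgroupOfEmb_apply_coe, map_add, map_sub, pointsMapOfEmb_smul] at h
    change _ + ((τ : absoluteGaloisGroup E) • mE - mE) = (τ : absoluteGaloisGroup E) • R - R at h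
    change _ = (τ : absoluteGaloisGroup E) • (R - mE) - (R - mE)
    rw [eq_sub_of_add_eq h, smul_sub]
    abel
  -- `Q := Ψ⁻¹ R'` and the crossed homomorphism `ψ = ι_* ∘ φ ∘ res` on `Gal(ℚ̄_E/ℚ_n·E)`
  let Q : localPoints W E := Ψ.symm R'
  have hΨQ : Ψ Q = R' := AddEquiv.apply_symm_apply _ _
  let ψ : B → localPoints W E := fun τ ↦
    pointsMapOfEmb W ι ((φ.1 (resGalSubgroupOfEmb (κ.layerSubgroup n) ι τ) : W.geomPrimaryTorsion p) :
      W.geomPoints)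
  have hψ : ∀ σ τ : B, ψ (σ * τ) = ψ σ + (σ : absoluteGaloisGroup E) • ψ τ := by
    intro σ τ
    change pointsMapOfEmb W ι _ = pointsMapOfEmb W ι _ + _ • pointsMapOfEmb W ι _
    rw [map_mul, φ.2, AddMemClass.coe_add, map_add]
    congr 1
    change pointsMapOfEmb W ι ((((resGalSubgroupOfEmb (κ.layerSubgroup n) ι σ) •
      φ.1 (resGalSubgroupOfEmb (κ.layerSubgroup n) ι τ) : W.geomPrimaryTorsion p)) : W.geomPoints) = _
    rw [primaryComponent.coe_smul]
    exact pointsMapOfEmb_smul W ι (σ : absoluteGaloisGroup E) _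
  have hQ : ∀ a : B, a ∈ N → ψ a = (a : absoluteGaloisGroup E) • Q - Q := by
    intro a ha
    have haU : (a : absoluteGaloisGroup E) ∈ localSubgroupOfEmb (towerSubgroup κ K₀ n) ι :=
      Subgroup.mem_subgroupOf.mp ha
    have h := hΘφ ⟨a, haU⟩
    rw [show subgroupInclusion h1 (resGalSubgroupOfEmb (towerSubgroup κ K₀ n) ι ⟨a, haU⟩) =
      resGalSubgroupOfEmb (κ.layerSubgroup n) ι a from Subtype.ext rfl] at h
    change pointsMap V E _ = _ at h
    rw [pointsMap_geomTransport] at h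
    change Ψ (ψ a) = (a : absoluteGaloisGroup E) • R' - R' at h
    apply Ψ.injective
    rw [h, map_sub, ← hΨQ,
      localTransport_smul_of_smul_root_eq W K₀ hθ hc hCV E ι
        (apply_rootInClosure_of_mem K₀ (towerSubgroup_le_galRange κ K₀ n haU))]
  -- (G1): `d • ψ` is principal with point `Q₂ = Tr Q − m₀`
  set d := Fintype.card (B ⧸ N) with hd
  have hG1 := cochain_index_nsmul_eq N ψ hψ Q hQ
  -- `Tr Q` is the `W`-side pair trace, `m₀ = ι_*(torsion)`
  have htr : (∑ q : B ⧸ N, (((q.out : B)) : absoluteGaloisGroup E) • Q) =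
      localPairTraceOfEmb ι W (κ.layerSubgroup n) (towerSubgroup κ K₀ n) Q :=
    (localPairTraceOfEmb_apply ι W (κ.layerSubgroup n) (towerSubgroup κ K₀ n) Q).symm
  obtain ⟨K₀', hK₀'⟩ := AddCommGroup.mem_primaryComponent.mp
    (∑ q : B ⧸ N, φ.1 (resGalSubgroupOfEmb (κ.layerSubgroup n) ι q.out)).2
  have hm₀ : p ^ K₀' • (∑ q : B ⧸ N, ψ q.out) = 0 := by
    change p ^ K₀' • ∑ q : B ⧸ N, pointsMapOfEmb W ι _ = 0
    rw [← map_sum, ← map_nsmul, ← AddSubmonoidClass.coe_finsetSum, hK₀', map_zero]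
  -- the `p`-power multiple of `Q₂` is the η-average trace of (D4b3)
  set S'' := p ^ K₀' • (p ^ (k + k₁) • R') with hS''
  have hS''mem : S'' ∈ towerSignedLocalPointsOfEmb (towerSubgroup κ K₀) ι V (-1) n :=
    AddSubgroup.nsmul_mem _ hR'mem _
  have hpKQ : p ^ (K₀' + (k + k₁)) • Q = Ψ.symm S'' := by
    rw [pow_add, mul_nsmul', hS'', map_nsmul, map_nsmul]
  have hQ₂ : p ^ (K₀' + (k + k₁)) • ((∑ q : B ⧸ N, (((q.out : B)) : absoluteGaloisGroup E) • Q) -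
      ∑ q : B ⧸ N, ψ q.out) =
      localPairTraceOfEmb ι W (κ.layerSubgroup n) (towerSubgroup κ K₀ n) (Ψ.symm S'') := by
    rw [smul_sub, show p ^ (K₀' + (k + k₁)) • (∑ q : B ⧸ N, ψ q.out) = 0 by
      rw [pow_add, mul_nsmul, hm₀, smul_zero], sub_zero, htr, ← map_nsmul, hpKQ]
  have hD4b3 := localPairTrace_localTransport_symm_mem_signed W K₀ hθ hc κ hCV ι η hη hD hκ₀ hS''mem
  -- the `W`-witness for `d • x`
  have hmem : d • oneCocycleClass _ φ ∈ localKummerOverOfEmb W p (κ.layerSubgroup n) ι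
      (strictSignedLocalPointsOfEmb κ ι W (-1) n) := by
    refine ⟨(d : ℤ) • φ, (∑ q : B ⧸ N, (((q.out : B)) : absoluteGaloisGroup E) • Q) -
      ∑ q : B ⧸ N, ψ q.out, K₀' + (k + k₁), ?_, ?_, fun τ ↦ ?_⟩
    · rw [← oneCocycleClassₗ_apply, map_zsmul, oneCocycleClassₗ_apply, natCast_zsmul]
    · rw [hQ₂]
      exact signed_inf_ker_le_strictSigned W p κ ι n
        (AddSubgroup.mem_inf.mpr ⟨hD4b3.1, (AddMonoidHom.mem_ker).mpr hD4b3.2⟩)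
    · have hvalφ : (((d : ℤ) • φ).1 (resGalSubgroupOfEmb (κ.layerSubgroup n) ι τ) :
          W.geomPrimaryTorsion p) = d • φ.1 (resGalSubgroupOfEmb (κ.layerSubgroup n) ι τ) := by
        rw [Submodule.coe_smul, ContinuousMap.smul_apply, natCast_zsmul]
      rw [hvalφ, AddSubmonoidClass.coe_nsmul, map_nsmul]
      exact hG1 τ
  -- `x` is `p`-primary and `d` is prime to `p`
  have hclosed : IsClosed ((κ.layerSubgroup n : Subgroup (absoluteGaloisGroup ℚ)) :
      Set (absoluteGaloisGroup ℚ)) :=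
    Subgroup.isClosed_of_isOpen _ (κ.isOpen_layerSubgroup n)
  obtain ⟨j, hj⟩ := exists_pow_nsmul_eq_zero_subgroupH1_of_isClosed W p hclosed (oneCocycleClass _ φ)
  exact mem_of_coprime_nsmul_mem p _ hj
    (Nat.Coprime.coprime_dvd_left (card_layerQuotient_dvd_index_galRange K₀ p κ E ι n) hcop) hmem

include hθ hη in
/-- **(D4c) THE KUMMER DICTIONARY at `p`** (both directions): for `K₀ = ℚ(μ_p)`-type data
(`κ(Gal(ℚ̄/K₀)) = ℤ_p`, `p ∤ [Γ_ℚ : Gal(ℚ̄/K₀)]`), a class `x ∈ H¹(Gal(ℚ̄/ℚ_n), W[p^∞])` satisfies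
p17's STRICT signed Kummer condition at the chosen embedding iff `Θ_n x` satisfies cc-typer-6's
VERBATIM minus Kummer condition `E⁻_V(K_{n,v}) ⊗ ℚ_p/ℤ_p` (with the `m = −1` clause).
[cite: Kobayashi2003, §2 p. 4, Def. 1.1, Def. 2.1 (p. 5)] -/
theorem mem_localKummerOverOfEmb_strictSigned_iff [(galRange (K := ℚ) K₀).Normal]
    (hD : ∀ g : absoluteGaloisGroup ℚ, ∃ τ : absoluteGaloisGroup E,
      (resGalOfEmb (closureEmb (K := ℚ) E) τ)⁻¹ * g ∈ towerTopSubgroup κ K₀)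
    (hκ₀ : ∀ x, ∃ g ∈ galRange (K := ℚ) K₀, κ g = x)
    (hcop : (galRange (K := ℚ) K₀).index.Coprime p) (n : ℕ)
    (x : W.subgroupH1 p (κ.layerSubgroup n)) :
    x ∈ localKummerOverOfEmb W p (κ.layerSubgroup n) (closureEmb (K := ℚ) E)
        (strictSignedLocalPointsOfEmb κ (closureEmb (K := ℚ) E) W (-1) n) ↔
      h1TransportLayer W K₀ hθ hc p κ hCV n x ∈
        localKummerOverOfEmb V p (towerSubgroup κ K₀ n) (closureEmb (K := ℚ) E)
          (towerSignedLocalPointsOfEmb (towerSubgroup κ K₀) (closureEmb (K := ℚ) E) V (-1) n) :=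
  ⟨h1TransportLayer_mem_localKummer_towerSigned W K₀ hθ hc p κ hCV E hD hκ₀ n,
    mem_localKummer_strictSigned_of_h1TransportLayer_mem W K₀ hθ hc p κ hCV E η hη hD hκ₀ hcop n⟩

end KummerBackward

end Summit.BirchSwinnertonDyer.Rank1Residual.Additive.SignedTwist
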